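import Mathlib.Algebra.MvPolynomial.Funext
import Mathlib.RingTheory.Ideal.Maximal
import Mathlib.RingTheory.Ideal.Quotient.Operations
import Literature.AlgebraicGeometry.Resolution.MvPolynomialKillVars
import HarnessLib

/-!
# Translation-invariant ideals of polynomial rings over infinite fields

Topic: `Literature/AlgebraicGeometry/Resolution`. Pure algebra for the functoriality argument
showing that a blow-up sequence functor commuting with smooth morphisms (Kollár 2007, 3.34.1)
blows up a linear subspace `L = V(yᵢ : i ∈ s) ⊆ 𝔸ⁿ_K` at once when resolving `(𝔸ⁿ_K, 𝓘_L, 1, ∅)`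
(`CanonicalResolutionKollar*.lean`: the first centre is invariant under the translations of
`𝔸ⁿ_K` along `L`, hence equals `L`). All statements PROVED, no definitions:

* `MvPolynomial.eq_zero_of_forall_eval_add_algebraMap` — a polynomial over a field extension
  `K'` of an INFINITE field `K` vanishing on a translate `c + Kᵗ` of the rational grid is zero
  (Mathlib `MvPolynomial.funext_set`);
* `MvPolynomial.eq_span_X_image_of_forall_aeval_mem` — **an ideal `𝔠 ⊊ K[yᵢ : i ∈ τ]`
  containing the variables `yᵢ`, `i ∈ s`, and stable under all translations
  `yᵢ ↦ yᵢ + aᵢ` with `aᵢ = 0` for `i ∈ s` (`aᵢ ∈ K`) is the ideal `(yᵢ : i ∈ s)`**, for `K`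
  infinite: modulo `(yᵢ : i ∈ s)` (Mathlib `MvPolynomial.killCompl`,
  `ker_killCompl` of `MvPolynomialKillVars.lean`) an element of `𝔠` becomes a polynomial in the
  remaining variables all of whose rational translates vanish at a point of `V(𝔠) ≠ ∅` with values
  in a residue field `K' ⊇ K`, hence it vanishes on a translate of the rational grid.

## Sources

* J. Kollár, *Lectures on Resolution of Singularities*, Ann. of Math. Stud. 166 (2007), 3.34.1
  (functoriality with respect to smooth morphisms; the use made of it here is the standard
  "equivariance under group actions" consequence, cf. 3.9.1). [Kollar2007]
-/

namespace Literature.AlgebraicGeometry.Resolution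

open _root_.MvPolynomial

universe u v w

variable {K : Type u} [Field K] {τ : Type v}

/-- **A polynomial over a field extension `K' ⊇ K` of an infinite field `K` that vanishes at all
points `c + b`, `b ∈ Kᵗ` (a translate of the rational grid), is zero** (each side
`cᵢ + K ⊆ K'` of the box is infinite; Mathlib `MvPolynomial.funext_set`). [folklore] -/
theorem MvPolynomial.eq_zero_of_forall_eval_add_algebraMap [Infinite K] {K' : Type w} [Field K']
    [Algebra K K'] (c : τ → K') (G : MvPolynomial τ K')
    (h : ∀ b : τ → K, eval (fun i => c i + algebraMap K K' (b i)) G = 0) : G = 0 := by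
  let s : τ → Set K' := fun i => Set.range fun t : K => c i + algebraMap K K' t
  have hs : ∀ i, (s i).Infinite := fun i =>
    Set.infinite_range_of_injective fun t t' htt' =>
      (algebraMap K K').injective (add_left_cancel htt')
  refine funext_set s hs fun x hx => ?_
  choose b hb using fun i => (hx i (Set.mem_univ i) : x i ∈ s i)
  have hxb : x = fun i => c i + algebraMap K K' (b i) := funext fun i => (hb i).symm
  rw [hxb, map_zero]
  exact h b

/-- **Translation-invariant ideals between `(yᵢ : i ∈ s)` and `⊤` are `(yᵢ : i ∈ s)`.** Let `K`
be an infinite field, `s ⊆ τ`, and `𝔠 ≠ ⊤` an ideal of `K[yᵢ : i ∈ τ]` containing `yᵢ` for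
`i ∈ s` and stable under the `K`-algebra endomorphisms `yᵢ ↦ yᵢ + aᵢ` for all `a ∈ Kᵗ` with
`aᵢ = 0` (`i ∈ s`) (the translations of `𝔸ᵗ_K` along `L = V(yᵢ : i ∈ s)`). Then
`𝔠 = (yᵢ : i ∈ s)`. Proof: for `p ∈ 𝔠` let `p₀` be `p` with the variables `yᵢ`, `i ∈ s`, killed
(`p - p₀ ∈ (yᵢ : i ∈ s)`, so `p₀ ∈ 𝔠`); at a point of `V(𝔪)`, `𝔪 ⊇ 𝔠` maximal, with values
`c` in `K' = K[y]/𝔪`, all translates of `p₀` by `b ∈ K^{τ ∖ s}` vanish, so `p₀ = 0` by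
`MvPolynomial.eq_zero_of_forall_eval_add_algebraMap`. [folklore] -/
theorem MvPolynomial.eq_span_X_image_of_forall_aeval_mem [Infinite K] (s : Set τ)
    {𝔠 : Ideal (MvPolynomial τ K)} (h𝔠 : 𝔠 ≠ ⊤)
    (hs : Ideal.span (X '' s : Set (MvPolynomial τ K)) ≤ 𝔠)
    (hinv : ∀ a : τ → K, (∀ i ∈ s, a i = 0) →
      ∀ p ∈ 𝔠, aeval (fun i => X i + C (a i)) p ∈ 𝔠) :
    𝔠 = Ideal.span (X '' s : Set (MvPolynomial τ K)) := by
  classical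
  refine le_antisymm (fun p hp => ?_) hs
  -- kill the variables in `s`
  let f : {j : τ // j ∉ s} → τ := Subtype.val
  have hf : Function.Injective f := Subtype.val_injective
  set g : MvPolynomial {j : τ // j ∉ s} K := killCompl hf p with hg
  have hsub : p - rename f g ∈ Ideal.span (X '' s : Set (MvPolynomial τ K)) := by
    have := MvPolynomial.sub_rename_killCompl_mem hf (R := K) p
    rwa [MvPolynomial.compl_range_val_not_mem] at this
  have hp₀ : rename f g ∈ 𝔠 := by
    have h1 : p - (p - rename f g) ∈ 𝔠 := Ideal.sub_mem _ hp (hs hsub)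
    rwa [sub_sub_cancel] at h1
  suffices hg0 : g = 0 by
    rw [hg0, map_zero, sub_zero] at hsub
    exact hsub
  -- a point of `V(𝔠)` with values in a residue field `K'`
  obtain ⟨𝔪, h𝔪, h𝔠𝔪⟩ := Ideal.exists_le_maximal 𝔠 h𝔠
  letI : Field (MvPolynomial τ K ⧸ 𝔪) := Ideal.Quotient.field 𝔪
  let π : MvPolynomial τ K →ₐ[K] (MvPolynomial τ K ⧸ 𝔪) := Ideal.Quotient.mkₐ K 𝔪
  let c : {j : τ // j ∉ s} → MvPolynomial τ K ⧸ 𝔪 := fun j => π (X j.1)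
  have hG : MvPolynomial.map (algebraMap K (MvPolynomial τ K ⧸ 𝔪)) g = 0 := by
    refine MvPolynomial.eq_zero_of_forall_eval_add_algebraMap (K := K) c _ fun b => ?_
    -- the translation by `b`, extended by `0` on `s`
    let a : τ → K := fun i => if h : i ∈ s then 0 else b ⟨i, h⟩
    have ha : ∀ i ∈ s, a i = 0 := fun i hi => dif_pos hi
    have hmem : aeval (fun i => X i + C (a i)) (rename f g) ∈ 𝔪 :=
      h𝔠𝔪 (hinv a ha _ hp₀)
    have hzero : π (aeval (fun i => X i + C (a i)) (rename f g)) = 0 :=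
      Ideal.Quotient.eq_zero_iff_mem.mpr hmem
    rw [aeval_rename, ← AlgHom.comp_apply, comp_aeval] at hzero
    have hfun : (fun j : {j : τ // j ∉ s} => π ((fun i => X i + C (a i)) (f j))) =
        fun j => c j + algebraMap K (MvPolynomial τ K ⧸ 𝔪) (b j) := by
      funext j
      have haj : a (f j) = b j := by
        change (if h : j.1 ∈ s then 0 else b ⟨j.1, h⟩) = b j
        rw [dif_neg j.2]
      change π (X j.1 + C (a (f j))) = π (X j.1) + algebraMap K (MvPolynomial τ K ⧸ 𝔪) (b j)
      have hC : π (C (a (f j))) = algebraMap K (MvPolynomial τ K ⧸ 𝔪) (b j) := by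
        rw [haj, ← MvPolynomial.algebraMap_eq]
        exact π.commutes (b j)
      rw [map_add, hC]
    rw [Function.comp_def, hfun, aeval_def, ← eval_map] at hzero
    exact hzero
  exact MvPolynomial.map_injective (algebraMap K (MvPolynomial τ K ⧸ 𝔪))
    (algebraMap K (MvPolynomial τ K ⧸ 𝔪)).injective (by rw [hG, map_zero])

end Literature.AlgebraicGeometry.Resolution
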